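import Summits.Ventures.QEC.CircuitDistance.SMSchedule
import Mathlib.Data.List.Permutation
import Mathlib.Data.List.Nodup
import HarnessLib
import Summits.Ventures.QEC.CircuitDistance.SchedFamily936

/-!
# `SchedFamily936Complete` — completeness half of CARD-I: every `σ.Valid` is a member of `family936`

Part 2 of the ≤ 400-line split of idea-2 g4ʼs `SchedFamily936` (statements and names unchanged; part 1 = the family literal, keys and the
member lemmas).  §3 pigeonhole by the kernel (the template forces the keys to be orderings), §3b data-register clause, §4 the checker
`completeCheck` (one `decide +kernel`, ≈ 3 min) and `valid_iff_mem_family936`, `forall_valid_iff`.  qec-cdx-idea-2 g4, 2026-08-29.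
In-seat evidence; landing only on the directorʼs word.  Nothing here changes a deployed code.
-/

namespace Summit.Ventures.QEC.CircuitDistance
namespace SMSchedule


/-! ## 3. Pigeonhole, by the kernel: the template forces the keys to be orderings of `2…7` and of `1…6` -/

/-- "Exactly one `X`-type layer in each round `2…7`", read on the `X`-key. -/
def xCountOK (xs : List ℕ) : Bool := [2, 3, 4, 5, 6, 7].all fun r => xs.count r == 1
/-- "Exactly one `Z`-type layer in each round `1…6`", read on the `Z`-key. -/
def zCountOK (zs : List ℕ) : Bool := [1, 2, 3, 4, 5, 6].all fun r => zs.count r == 1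

/-- The `X`-type layers at round `r`, as a filter of the six `X`-type layers (order of `Layer.listed`). -/
theorem layersAt_ctrlX (σ : SMSchedule) (r : ℕ) :
    (σ.layersAt r fun l => l.ctrl == Reg.X) = [Layer.A2XL, .B2XR, .B1XR, .B3XR, .A1XL, .A3XL].filter fun l => σ.round l == r := by
  simp [layersAt, Layer.listed, List.filter_cons, Layer.ctrl]

/-- The `Z`-type layers at round `r`. -/
theorem layersAt_tgtZ (σ : SMSchedule) (r : ℕ) :
    (σ.layersAt r fun l => l.tgt == Reg.Z) = [Layer.A1RZ, .A3RZ, .B1LZ, .B2LZ, .B3LZ, .A2RZ].filter fun l => σ.round l == r := by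
  simp [layersAt, Layer.listed, List.filter_cons, Layer.tgt]

/-- Lemma `length_layersAt_ctrlX` (auxiliary step of the completeness proof; see the module docstring). -/
theorem length_layersAt_ctrlX (σ : SMSchedule) (r : ℕ) :
    (σ.layersAt r fun l => l.ctrl == Reg.X).length = σ.xKey.count r := by
  rw [layersAt_ctrlX, ← List.countP_eq_length_filter]
  have hp : [Layer.A2XL, .B2XR, .B1XR, .B3XR, .A1XL, .A3XL].Perm [.A1XL, .A2XL, .A3XL, .B1XR, .B2XR, .B3XR] := by decide
  rw [hp.countP_eq]
  simp [xKey, List.countP_cons, List.count_cons]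

/-- Lemma `length_layersAt_tgtZ` (auxiliary step of the completeness proof; see the module docstring). -/
theorem length_layersAt_tgtZ (σ : SMSchedule) (r : ℕ) :
    (σ.layersAt r fun l => l.tgt == Reg.Z).length = σ.zKey.count r := by
  rw [layersAt_tgtZ, ← List.countP_eq_length_filter]
  have hp : [Layer.A1RZ, .A3RZ, .B1LZ, .B2LZ, .B3LZ, .A2RZ].Perm [.B1LZ, .B2LZ, .B3LZ, .A1RZ, .A2RZ, .A3RZ] := by decide
  rw [hp.countP_eq]
  simp [zKey, List.countP_cons, List.count_cons]

/-- Lemma `xCountOK_of_templateOK`: `{σ : SMSchedule} (h : σ.templateOK = true) : xCountOK σ.xKey = true`. -/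
theorem xCountOK_of_templateOK {σ : SMSchedule} (h : σ.templateOK = true) : xCountOK σ.xKey = true := by
  unfold templateOK at h
  simp only [Bool.and_eq_true, List.all_eq_true] at h
  obtain ⟨⟨hX, -⟩, -⟩ := h
  unfold xCountOK
  simp only [List.all_eq_true]
  intro r hr
  have := hX r hr
  rw [← length_layersAt_ctrlX]
  simpa using this

/-- Lemma `zCountOK_of_templateOK`: `{σ : SMSchedule} (h : σ.templateOK = true) : zCountOK σ.zKey = true`. -/
theorem zCountOK_of_templateOK {σ : SMSchedule} (h : σ.templateOK = true) : zCountOK σ.zKey = true := by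
  unfold templateOK at h
  simp only [Bool.and_eq_true, List.all_eq_true] at h
  obtain ⟨⟨-, hZ⟩, -⟩ := h
  unfold zCountOK
  simp only [List.all_eq_true]
  intro r hr
  have := hZ r hr
  rw [← length_layersAt_tgtZ]
  simpa using this

/-- All lists of length `n` over the alphabet `D` (structural; for the kernel). -/
def allLists (D : List ℕ) : ℕ → List (List ℕ)
  | 0 => [[]]
  | n + 1 => (allLists D n).flatMap fun t => D.map fun a => a :: t

/-- Lemma `mem_allLists` (auxiliary step of the completeness proof; see the module docstring). -/
theorem mem_allLists (D : List ℕ) : ∀ (ys : List ℕ), (∀ a ∈ ys, a ∈ D) → ys ∈ allLists D ys.length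
  | [], _ => by simp [allLists]
  | a :: t, h => by
    simp only [List.length_cons, allLists, List.mem_flatMap, List.mem_map]
    exact ⟨t, mem_allLists D t (fun b hb => h b (List.mem_cons_of_mem a hb)), a, h a List.mem_cons_self, rfl⟩

/-- Truncation: keep the entries in `R`, send the others to `0`. -/
def trunc (R : List ℕ) (xs : List ℕ) : List ℕ := xs.map fun a => if a ∈ R then a else 0

/-- Lemma `trunc_length`: `(R xs : List ℕ) : (trunc R xs).length = xs.length`. -/
theorem trunc_length (R xs : List ℕ) : (trunc R xs).length = xs.length := by simp [trunc]

/-- Lemma `mem_trunc_alphabet`: `(R xs : List ℕ) : ∀ a ∈ trunc R xs, a ∈ 0 :: R`. -/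
theorem mem_trunc_alphabet (R xs : List ℕ) : ∀ a ∈ trunc R xs, a ∈ 0 :: R := by
  intro a ha
  simp only [trunc, List.mem_map] at ha
  obtain ⟨b, -, rfl⟩ := ha
  by_cases hb : b ∈ R <;> simp [hb]

/-- Lemma `count_trunc`: `{R : List ℕ} (h0 : 0 ∉ R) (xs : List ℕ) {r : ℕ} (hr : r ∈ R) : (trunc R xs).count r = xs.count r`. -/
theorem count_trunc {R : List ℕ} (h0 : 0 ∉ R) (xs : List ℕ) {r : ℕ} (hr : r ∈ R) : (trunc R xs).count r = xs.count r := by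
  unfold trunc
  simp only [List.count, List.countP_map]
  apply List.countP_congr
  intro a _
  by_cases ha : a ∈ R
  · simp [ha]
  · have hra : a ≠ r := fun e => ha (e ▸ hr)
    have hr0 : (0 : ℕ) ≠ r := fun e => h0 (e ▸ hr)
    simp [ha, hra, hr0]

/-- Lemma `eq_trunc_of_zero_not_mem`: `{R xs : List ℕ} (h : 0 ∉ trunc R xs) : trunc R xs = xs`. -/
theorem eq_trunc_of_zero_not_mem {R xs : List ℕ} (h : 0 ∉ trunc R xs) : trunc R xs = xs := by
  unfold trunc at *
  conv_rhs => rw [← List.map_id xs]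
  apply List.map_congr_left
  intro a ha
  by_cases hR : a ∈ R
  · simp [hR]
  · exfalso; apply h; exact List.mem_map.mpr ⟨a, ha, by simp [hR]⟩

/-- KERNEL PIGEONHOLE (`X`): over all `7⁶` truncated keys, "count = 1 for each of 2…7" forces no `0` and an ordering of `2…7`. -/
theorem truncFactX : ((allLists [0, 2, 3, 4, 5, 6, 7] 6).all fun ys =>
    !(xCountOK ys) || (!(ys.elem 0) && ys.isPerm [2, 3, 4, 5, 6, 7])) = true := by
  decide +kernel

/-- KERNEL PIGEONHOLE (`Z`). -/
theorem truncFactZ : ((allLists [0, 1, 2, 3, 4, 5, 6] 6).all fun ys =>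
    !(zCountOK ys) || (!(ys.elem 0) && ys.isPerm [1, 2, 3, 4, 5, 6])) = true := by
  decide +kernel

/-- Lemma `xCountOK_trunc`: `{xs : List ℕ} (h : xCountOK xs = true) : xCountOK (trunc [2, 3, 4, 5, 6, 7] xs) = true`. -/
theorem xCountOK_trunc {xs : List ℕ} (h : xCountOK xs = true) : xCountOK (trunc [2, 3, 4, 5, 6, 7] xs) = true := by
  unfold xCountOK at *
  rw [List.all_eq_true] at *
  intro r hr
  rw [count_trunc (by decide) xs hr]
  exact h r hr

/-- Lemma `zCountOK_trunc`: `{zs : List ℕ} (h : zCountOK zs = true) : zCountOK (trunc [1, 2, 3, 4, 5, 6] zs) = true`. -/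
theorem zCountOK_trunc {zs : List ℕ} (h : zCountOK zs = true) : zCountOK (trunc [1, 2, 3, 4, 5, 6] zs) = true := by
  unfold zCountOK at *
  rw [List.all_eq_true] at *
  intro r hr
  rw [count_trunc (by decide) zs hr]
  exact h r hr

/-- Lemma `perm_of_xCountOK`: `{xs : List ℕ} (hlen : xs.length = 6) (h : xCountOK xs = true) : xs.Perm [2, 3, 4, 5, 6, 7]`. -/
theorem perm_of_xCountOK {xs : List ℕ} (hlen : xs.length = 6) (h : xCountOK xs = true) : xs.Perm [2, 3, 4, 5, 6, 7] := by
  have hmem := mem_allLists [0, 2, 3, 4, 5, 6, 7] (trunc [2, 3, 4, 5, 6, 7] xs) (mem_trunc_alphabet _ _)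
  rw [trunc_length, hlen] at hmem
  have hall := List.all_eq_true.mp truncFactX _ hmem
  rw [xCountOK_trunc h] at hall
  simp only [Bool.not_true, Bool.false_or, Bool.and_eq_true, Bool.not_eq_true'] at hall
  obtain ⟨h0, hp⟩ := hall
  have h0' : 0 ∉ trunc [2, 3, 4, 5, 6, 7] xs := by simpa using h0
  rw [← eq_trunc_of_zero_not_mem h0']
  exact List.isPerm_iff.mp hp

/-- Lemma `perm_of_zCountOK`: `{zs : List ℕ} (hlen : zs.length = 6) (h : zCountOK zs = true) : zs.Perm [1, 2, 3, 4, 5, 6]`. -/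
theorem perm_of_zCountOK {zs : List ℕ} (hlen : zs.length = 6) (h : zCountOK zs = true) : zs.Perm [1, 2, 3, 4, 5, 6] := by
  have hmem := mem_allLists [0, 1, 2, 3, 4, 5, 6] (trunc [1, 2, 3, 4, 5, 6] zs) (mem_trunc_alphabet _ _)
  rw [trunc_length, hlen] at hmem
  have hall := List.all_eq_true.mp truncFactZ _ hmem
  rw [zCountOK_trunc h] at hall
  simp only [Bool.not_true, Bool.false_or, Bool.and_eq_true, Bool.not_eq_true'] at hall
  obtain ⟨h0, hp⟩ := hall
  have h0' : 0 ∉ trunc [1, 2, 3, 4, 5, 6] zs := by simpa using h0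
  rw [← eq_trunc_of_zero_not_mem h0']
  exact List.isPerm_iff.mp hp

/-- Lemma `xKey_perm_of_templateOK`: `{σ : SMSchedule} (h : σ.templateOK = true) : σ.xKey.Perm [2, 3, 4, 5, 6, 7]`. -/
theorem xKey_perm_of_templateOK {σ : SMSchedule} (h : σ.templateOK = true) : σ.xKey.Perm [2, 3, 4, 5, 6, 7] :=
  perm_of_xCountOK σ.xKey_length (xCountOK_of_templateOK h)

/-- Lemma `zKey_perm_of_templateOK`: `{σ : SMSchedule} (h : σ.templateOK = true) : σ.zKey.Perm [1, 2, 3, 4, 5, 6]`. -/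
theorem zKey_perm_of_templateOK {σ : SMSchedule} (h : σ.templateOK = true) : σ.zKey.Perm [1, 2, 3, 4, 5, 6] :=
  perm_of_zCountOK σ.zKey_length (zCountOK_of_templateOK h)

/-! ## 3b. The template also forces: the six layers on `q(L)` sit in six distinct rounds, likewise on `q(R)` -/

/-- Rounds of the six layers meeting data register `q(L)` (`A₁,A₂,A₃ (X→L)`, `B₁,B₂,B₃ (L→Z)`) … -/
def lKey (σ : SMSchedule) : List ℕ :=
  [σ.round .A1XL, σ.round .A2XL, σ.round .A3XL, σ.round .B1LZ, σ.round .B2LZ, σ.round .B3LZ]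

/-- … and meeting `q(R)` (`B₁,B₂,B₃ (X→R)`, `A₁,A₂,A₃ (R→Z)`). -/
def rKey (σ : SMSchedule) : List ℕ :=
  [σ.round .B1XR, σ.round .B2XR, σ.round .B3XR, σ.round .A1RZ, σ.round .A2RZ, σ.round .A3RZ]

/-- Lemma `lKey_eq`: `(σ : SMSchedule) : σ.lKey = σ.xKey.take 3 ++ σ.zKey.take 3`. -/
theorem lKey_eq (σ : SMSchedule) : σ.lKey = σ.xKey.take 3 ++ σ.zKey.take 3 := rfl
/-- Lemma `rKey_eq`: `(σ : SMSchedule) : σ.rKey = σ.xKey.drop 3 ++ σ.zKey.drop 3`. -/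
theorem rKey_eq (σ : SMSchedule) : σ.rKey = σ.xKey.drop 3 ++ σ.zKey.drop 3 := rfl

/-- Lemma `layersAt_dataL` (auxiliary step of the completeness proof; see the module docstring). -/
theorem layersAt_dataL (σ : SMSchedule) (r : ℕ) :
    (σ.layersAt r fun l => l.dataReg == Reg.L) = [Layer.A2XL, .B1LZ, .B2LZ, .B3LZ, .A1XL, .A3XL].filter fun l => σ.round l == r := by
  simp [layersAt, Layer.listed, List.filter_cons, Layer.dataReg, Layer.ctrl, Layer.tgt]

/-- Lemma `layersAt_dataR` (auxiliary step of the completeness proof; see the module docstring). -/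
theorem layersAt_dataR (σ : SMSchedule) (r : ℕ) :
    (σ.layersAt r fun l => l.dataReg == Reg.R) = [Layer.A1RZ, .A3RZ, .B2XR, .B1XR, .B3XR, .A2RZ].filter fun l => σ.round l == r := by
  simp [layersAt, Layer.listed, List.filter_cons, Layer.dataReg, Layer.ctrl, Layer.tgt]

/-- Lemma `length_layersAt_dataL` (auxiliary step of the completeness proof; see the module docstring). -/
theorem length_layersAt_dataL (σ : SMSchedule) (r : ℕ) :
    (σ.layersAt r fun l => l.dataReg == Reg.L).length = σ.lKey.count r := by
  rw [layersAt_dataL, ← List.countP_eq_length_filter]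
  have hp : [Layer.A2XL, .B1LZ, .B2LZ, .B3LZ, .A1XL, .A3XL].Perm [.A1XL, .A2XL, .A3XL, .B1LZ, .B2LZ, .B3LZ] := by decide
  rw [hp.countP_eq]
  simp [lKey, List.countP_cons, List.count_cons]

/-- Lemma `length_layersAt_dataR` (auxiliary step of the completeness proof; see the module docstring). -/
theorem length_layersAt_dataR (σ : SMSchedule) (r : ℕ) :
    (σ.layersAt r fun l => l.dataReg == Reg.R).length = σ.rKey.count r := by
  rw [layersAt_dataR, ← List.countP_eq_length_filter]
  have hp : [Layer.A1RZ, .A3RZ, .B2XR, .B1XR, .B3XR, .A2RZ].Perm [.B1XR, .B2XR, .B3XR, .A1RZ, .A2RZ, .A3RZ] := by decide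
  rw [hp.countP_eq]
  simp [rKey, List.countP_cons, List.count_cons]

/-- "Each data register meets at most one layer per round", read on the two data keys. -/
theorem dataCount_of_templateOK {σ : SMSchedule} (h : σ.templateOK = true) {r : ℕ} (hr : r ∈ [1, 2, 3, 4, 5, 6, 7]) :
    σ.lKey.count r ≤ 1 ∧ σ.rKey.count r ≤ 1 := by
  unfold templateOK at h
  simp only [Bool.and_eq_true, List.all_eq_true, decide_eq_true_eq] at h
  obtain ⟨-, hLR⟩ := h
  have := hLR r hr
  rwa [length_layersAt_dataL, length_layersAt_dataR] at this

/-- Lemma `mem17_of_mem_lKey` (auxiliary step of the completeness proof; see the module docstring). -/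
theorem mem17_of_mem_lKey {σ : SMSchedule} (hT : σ.templateOK = true) {a : ℕ} (ha : a ∈ σ.lKey) :
    a ∈ [1, 2, 3, 4, 5, 6, 7] := by
  rw [lKey_eq, List.mem_append] at ha
  rcases ha with ha | ha
  · have := (xKey_perm_of_templateOK hT).mem_iff.mp (List.mem_of_mem_take ha)
    simp only [List.mem_cons, List.not_mem_nil, or_false] at this ⊢
    omega
  · have := (zKey_perm_of_templateOK hT).mem_iff.mp (List.mem_of_mem_take ha)
    simp only [List.mem_cons, List.not_mem_nil, or_false] at this ⊢
    omega

/-- Lemma `mem17_of_mem_rKey` (auxiliary step of the completeness proof; see the module docstring). -/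
theorem mem17_of_mem_rKey {σ : SMSchedule} (hT : σ.templateOK = true) {a : ℕ} (ha : a ∈ σ.rKey) :
    a ∈ [1, 2, 3, 4, 5, 6, 7] := by
  rw [rKey_eq, List.mem_append] at ha
  rcases ha with ha | ha
  · have := (xKey_perm_of_templateOK hT).mem_iff.mp (List.mem_of_mem_drop ha)
    simp only [List.mem_cons, List.not_mem_nil, or_false] at this ⊢
    omega
  · have := (zKey_perm_of_templateOK hT).mem_iff.mp (List.mem_of_mem_drop ha)
    simp only [List.mem_cons, List.not_mem_nil, or_false] at this ⊢
    omega

/-- Lemma `lKey_nodup`: `{σ : SMSchedule} (hT : σ.templateOK = true) : σ.lKey.Nodup`. -/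
theorem lKey_nodup {σ : SMSchedule} (hT : σ.templateOK = true) : σ.lKey.Nodup := by
  rw [List.nodup_iff_count_le_one]
  intro a
  by_cases ha : a ∈ [1, 2, 3, 4, 5, 6, 7]
  · exact (dataCount_of_templateOK hT ha).1
  · rw [List.count_eq_zero_of_not_mem fun hm => ha (mem17_of_mem_lKey hT hm)]
    exact Nat.zero_le 1

/-- Lemma `rKey_nodup`: `{σ : SMSchedule} (hT : σ.templateOK = true) : σ.rKey.Nodup`. -/
theorem rKey_nodup {σ : SMSchedule} (hT : σ.templateOK = true) : σ.rKey.Nodup := by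
  rw [List.nodup_iff_count_le_one]
  intro a
  by_cases ha : a ∈ [1, 2, 3, 4, 5, 6, 7]
  · exact (dataCount_of_templateOK hT ha).2
  · rw [List.count_eq_zero_of_not_mem fun hm => ha (mem17_of_mem_rKey hT hm)]
    exact Nat.zero_le 1

/-! ## 4. The checker, and completeness -/

/-- The `n`-element arrangements (ordered, no repetition) from `D` (structural; for the kernel). -/
def arr (D : List ℕ) : ℕ → List (List ℕ)
  | 0 => [[]]
  | n + 1 => (arr D n).flatMap fun t => (D.filter fun a => !(t.elem a)).map fun a => a :: t

/-- Lemma `mem_arr` (auxiliary step of the completeness proof; see the module docstring). -/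
theorem mem_arr (D : List ℕ) : ∀ (ys : List ℕ), ys.Nodup → (∀ a ∈ ys, a ∈ D) → ys ∈ arr D ys.length
  | [], _, _ => by simp [arr]
  | a :: t, hn, h => by
    obtain ⟨ha, ht⟩ := List.nodup_cons.mp hn
    simp only [List.length_cons, arr, List.mem_flatMap, List.mem_map, List.mem_filter]
    refine ⟨t, mem_arr D t ht (fun b hb => h b (List.mem_cons_of_mem a hb)), a, ⟨h a List.mem_cons_self, ?_⟩, rfl⟩
    simpa using ha

/-- Candidate `X`-keys: the `720` orderings of `2…7` (`List.permutations'`). -/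
def xCands : List (List ℕ) := List.permutations' [2, 3, 4, 5, 6, 7]

/-- For an `X`-key: the rounds of `1…6` left free on `q(L)` by `A₁,A₂,A₃ (X→L)` / left free on `q(R)` by `B₁,B₂,B₃ (X→R)`. -/
def freeL (xs : List ℕ) : List ℕ := [1, 2, 3, 4, 5, 6].filter fun b => !((xs.take 3).elem b)
/-- Definition `freeR`: `(xs : List ℕ) : List ℕ`. -/
def freeR (xs : List ℕ) : List ℕ := [1, 2, 3, 4, 5, 6].filter fun b => !((xs.drop 3).elem b)

/-- THE CHECKER. For every ordering `xs` of `2…7` and every `Z`-key `zl ++ zr` with `zl` three distinct free `q(L)`-rounds and `zr`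
three distinct free `q(R)`-rounds (`720 · 144` candidates; §3/§3b show every template-valid schedule is among them), if the six
`Z`-rounds are distinct and the schedule passes the UNCHANGED `parityOK`, then its key pair is a family key. -/
def completeCheck : Bool :=
  xCands.all fun xs => (arr (freeL xs) 3).all fun zl => (arr (freeR xs) 3).all fun zr =>
    !(nodupB (zl ++ zr)) || (!(ofKeys xs (zl ++ zr)).parityOK || familyKeys.elem (xs, zl ++ zr))

/-- Lemma `completeCheck_eq_true`: `completeCheck = true`. -/
theorem completeCheck_eq_true : completeCheck = true := by
  decide +kernel

/-- **COMPLETENESS.** Every schedule passing print's template and criterion O1 is one of the 936. -/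
theorem mem_family936_of_valid {σ : SMSchedule} (h : σ.Valid) : σ ∈ family936 := by
  obtain ⟨hT, hP⟩ := h
  have hx : σ.xKey ∈ xCands := List.mem_permutations'.mpr (xKey_perm_of_templateOK hT)
  have hz6 : ∀ a ∈ σ.zKey, a ∈ [1, 2, 3, 4, 5, 6] := fun a ha => (zKey_perm_of_templateOK hT).mem_iff.mp ha
  have hL := List.nodup_append.mp (σ.lKey_eq ▸ lKey_nodup hT)
  have hR := List.nodup_append.mp (σ.rKey_eq ▸ rKey_nodup hT)
  have hzl : σ.zKey.take 3 ∈ arr (freeL σ.xKey) 3 := by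
    have hlen : (σ.zKey.take 3).length = 3 := rfl
    have := mem_arr (freeL σ.xKey) (σ.zKey.take 3) hL.2.1 fun a ha => by
      unfold freeL
      rw [List.mem_filter]
      refine ⟨hz6 a (List.mem_of_mem_take ha), ?_⟩
      simpa using fun hm : a ∈ σ.xKey.take 3 => hL.2.2 a hm a ha rfl
    rwa [hlen] at this
  have hzr : σ.zKey.drop 3 ∈ arr (freeR σ.xKey) 3 := by
    have hlen : (σ.zKey.drop 3).length = 3 := rfl
    have := mem_arr (freeR σ.xKey) (σ.zKey.drop 3) hR.2.1 fun a ha => by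
      unfold freeR
      rw [List.mem_filter]
      refine ⟨hz6 a (List.mem_of_mem_drop ha), ?_⟩
      simpa using fun hm : a ∈ σ.xKey.drop 3 => hR.2.2 a hm a ha rfl
    rwa [hlen] at this
  have hc := completeCheck_eq_true
  unfold completeCheck at hc
  have h3 := List.all_eq_true.mp (List.all_eq_true.mp (List.all_eq_true.mp hc _ hx) _ hzl) _ hzr
  rw [List.take_append_drop] at h3
  have hnd : nodupB σ.zKey = true := nodupB_of_nodup ((zKey_perm_of_templateOK hT).nodup_iff.mpr (by decide))
  rw [hnd, ofKeys_keys, hP] at h3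
  simp only [Bool.not_true, Bool.false_or] at h3
  have hm : (σ.xKey, σ.zKey) ∈ familyKeys := List.elem_iff.mp h3
  obtain ⟨τ, hτ, hk⟩ := List.mem_map.mp hm
  simp only [Prod.mk.injEq] at hk
  exact eq_of_keys_eq hk.1 hk.2 ▸ hτ

/-- **The valid orders are exactly the 936 listed ones.** -/
theorem valid_iff_mem_family936 (σ : SMSchedule) : σ.Valid ↔ σ ∈ family936 :=
  ⟨mem_family936_of_valid, valid_of_mem_family936⟩

/-- Consumer form: a statement about all valid orders is a statement about the 936 members. -/
theorem forall_valid_iff (P : SMSchedule → Prop) : (∀ σ, σ.Valid → P σ) ↔ ∀ σ ∈ family936, P σ :=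
  ⟨fun h σ hσ => h σ (valid_of_mem_family936 hσ), fun h σ hσ => h σ (mem_family936_of_valid hσ)⟩

end SMSchedule

end Summit.Ventures.QEC.CircuitDistance
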